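import Mathlib
import Summits.MatrixMultiplication.MatrixMultiplication.Theses.FourierTwoFamiliesModP
import Summits.MatrixMultiplication.MatrixMultiplication.Theorems.FourierTwoFamiliesModPCyclicReductionTransfer
import Summits.MatrixMultiplication.MatrixMultiplication.Theorems.FourierTwoFamiliesModPPrimeTwoFamiliesCapacityLift
import Literature.Computability.AlgebraicComplexity.SimultaneousDoubleProduct

/-!
# Self-converse gadgets `↔ PrimeTwoFamilies` — the explicit two-letter route (support file)

Item `stmt-MatrixMultiplication-14308` (`FourierTwoFamiliesModP.PrimeTwoFamilies`, CKSU 2005 Conj. 4.7 with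
prime cyclic hosts), line `Sketch` (capacity-gadget skeleton `Cruxes/PrimeTwoFamilies/Lines/Sketch.lean`),
registered stub `selfConverseGadgets_iff_primeTwoFamilies` (siege k14: explicit / elementary variation).

A *self-converse gadget* of slice `ε` is a list of `r` direct pairs `(P c, Q c)_{c<r}` in `ℤ/m` and a map
`π : Fin r → Fin r` such that every ordered pair of distinct letters `σ ≠ τ` is strongly separated (every
cross difference `q - p`, `p ∈ P σ`, `q ∈ Q τ`, avoids every diagonal difference `q' - p'`, `p' ∈ P c`,
`q' ∈ Q c`) either directly or after `π`, with `m ^ (1-ε) ≤ r` and co-volumes `m ^ (1-ε) ≤ |P c| |Q c|`,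
for arbitrarily large `m`.  The theorem: such gadgets exist for every `ε > 0` iff the crux holds.

This file gives a second, EXPLICIT proof of the equivalence (the tree's
`CapacityLift.selfConverseGadgets_iff_primeTwoFamilies` goes through general zero-error codes of arbitrary
word length `L` and a bookkeeping lemma uniform in `L`).  Here everything happens at word length two with
explicit constants:

* ONE LEVEL (`exists_prime_sdpp_of_selfConverseGadget`, public): a self-converse gadget in `ℤ/m` gives, in
  some prime `p ≤ 18 m²`, an SDPP family of `r` pairs with `|A σ||B σ| = |P σ||Q σ|·|P (π σ)||Q (π σ)|` —
  the `r` product blocks `(P σ ×ˢ P (π σ), Q σ ×ˢ Q (π σ))` in `ℤ/m × ℤ/m` are an SDPP family (tree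
  `CapacityLift.selfConverseLift`) and the carry-free Bertrand transfer
  `Theorems.exists_prime_sdpp_of_addEquiv` (two cyclic factors) moves them into `ℤ/p` with sizes kept.
* (⇒) `slice_of_gadgets`: the explicit bookkeeping `bookkeeping_two` (`ε = δ/8`, keep
  `n = max n₀ ⌈(18 m²) ^ (1/(2+δ))⌉₊` blocks, threshold `18 (n₀+2)^(2+δ) m² ≤ m ^ ((1-δ/8)(2+δ))`) gives
  `p ≤ n ^ (2+δ)`, `n ≤ m ^ (1-δ/8) ≤ r` and `n ^ (2-δ) ≤ (m ^ (1-δ/8))² ≤` co-volume; slices `δ > 1`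
  follow from the slice `min δ 1` because `n ≥ 1`.
* (⇐) `gadgets_of_crux`: letter repetition — from a witness `(A i, B i)_{i<n}` in `ℤ/p` of the slice
  `δ = min ε 1` take `m = p`, `r = n²` letters `(i, i') ↦ (A i, B i)` and `π (i, i') = (i', i')`; clause (X)
  separates letters with distinct first index directly and letters with equal first index after `π`;
  the exponents are explicit: `p ^ (1-ε) ≤ p ^ (1-δ) ≤ n ^ ((2+δ)(1-δ)) ≤ n ^ (2-δ) ≤ min (n², |A i||B i|)`.
-/

-- single-conjunct summit: the mandated namespace repeats `MatrixMultiplication` (summit = sub-problem).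
set_option linter.dupNamespace false

namespace Summit.MatrixMultiplication.MatrixMultiplication.Theorems.PrimeTwoFamilies.SelfConverseExplicitK14

open Finset
open Summit.MatrixMultiplication.MatrixMultiplication.Theses
open Summit.MatrixMultiplication.MatrixMultiplication.Theorems
open Literature.Computability.AlgebraicComplexity

/-! ## Explicit bookkeeping at word length two -/

-- adapted from Summits/MatrixMultiplication/MatrixMultiplication/Theorems/
--   FourierTwoFamiliesModPPrimeTwoFamiliesStubCapBookkeeping.lean (`eventually_dominates`, private there)
/-- A constant multiple of a smaller real power of `m` is eventually dominated by a larger power: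
if `0 < K` and `a < b` then `K * m ^ a ≤ m ^ b` for all naturals `m ≥ ⌈K ^ (1/(b-a))⌉₊ + 1`. -/
private theorem eventually_dominates (K a b : ℝ) (hK : 0 < K) (hab : a < b) :
    ∃ m₀ : ℕ, ∀ m : ℕ, m₀ ≤ m → K * (m : ℝ) ^ a ≤ (m : ℝ) ^ b := by
  have hc : 0 < b - a := sub_pos.mpr hab
  refine ⟨⌈K ^ (b - a)⁻¹⌉₊ + 1, fun m hm => ?_⟩
  have hm1 : ((⌈K ^ (b - a)⁻¹⌉₊ + 1 : ℕ) : ℝ) ≤ m := by exact_mod_cast hm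
  push_cast at hm1
  have hceil : K ^ (b - a)⁻¹ ≤ (⌈K ^ (b - a)⁻¹⌉₊ : ℝ) := Nat.le_ceil _
  have hT0 : (0 : ℝ) ≤ K ^ (b - a)⁻¹ := Real.rpow_nonneg hK.le _
  have hKm' : K ^ (b - a)⁻¹ ≤ (m : ℝ) := by linarith
  have hm0 : (0 : ℝ) < m := by linarith
  have hKm : K ≤ (m : ℝ) ^ (b - a) := by
    calc K = (K ^ (b - a)⁻¹) ^ (b - a) := (Real.rpow_inv_rpow hK.le hc.ne').symm
      _ ≤ (m : ℝ) ^ (b - a) := Real.rpow_le_rpow hT0 hKm' hc.le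
  calc K * (m : ℝ) ^ a ≤ (m : ℝ) ^ (b - a) * (m : ℝ) ^ a :=
        mul_le_mul_of_nonneg_right hKm (Real.rpow_nonneg hm0.le _)
    _ = (m : ℝ) ^ b := by rw [← Real.rpow_add hm0, sub_add_cancel]

/-- **Explicit bookkeeping of the two-letter lift.**  For `0 < δ ≤ 1` and every `n₀` there is a threshold
`m₀` such that for `m ≥ m₀`, any number `r ≥ m ^ (1 - δ/8)` of blocks and any host `p ≤ 18 m²` leave
room for a number `n` of blocks with `n₀ ≤ n ≤ r`, `p ≤ n ^ (2+δ)` and `n ^ (2-δ) ≤ (m ^ (1-δ/8))²`.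
Choice: `n = max n₀ ⌈(18 m²) ^ (1/(2+δ))⌉₊ ≤ B := (n₀ + 2)(18 m²) ^ (1/(2+δ))`, and the threshold
`18 (n₀+2) ^ (2+δ) · m² ≤ m ^ ((1-δ/8)(2+δ))` (possible since `(1-δ/8)(2+δ) = 2 + δ(6-δ)/8 > 2`) gives
`B ≤ m ^ (1-δ/8)`, whence `n ≤ r` and `n ^ (2-δ) ≤ (m ^ (1-δ/8)) ^ (2-δ) ≤ (m ^ (1-δ/8))²`. -/
private theorem bookkeeping_two (δ : ℝ) (hδ : 0 < δ) (hδ1 : δ ≤ 1) (n₀ : ℕ) :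
    ∃ m₀ : ℕ, ∀ m : ℕ, m₀ ≤ m → ∀ r : ℕ, (m : ℝ) ^ (1 - δ / 8) ≤ (r : ℝ) →
      ∀ p : ℕ, p ≤ 18 * m ^ 2 →
        ∃ n : ℕ, n₀ ≤ n ∧ n ≤ r ∧ (p : ℝ) ≤ (n : ℝ) ^ (2 + δ) ∧
          (n : ℝ) ^ (2 - δ) ≤ ((m : ℝ) ^ (1 - δ / 8)) ^ 2 := by
  have h2δ : (0 : ℝ) < 2 + δ := by positivity
  /- the constant `q = (n₀+2)^(2+δ)` and the threshold `18 q m² ≤ m ^ ((1-δ/8)(2+δ))` -/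
  have h02 : (0 : ℝ) ≤ (n₀ : ℝ) + 2 := by positivity
  have hq1 : (1 : ℝ) ≤ ((n₀ : ℝ) + 2) ^ (2 + δ) :=
    Real.one_le_rpow (by linarith [(n₀.cast_nonneg : (0 : ℝ) ≤ n₀)]) h2δ.le
  set q : ℝ := ((n₀ : ℝ) + 2) ^ (2 + δ) with hq
  have hq0 : (0 : ℝ) < q := one_pos.trans_le hq1
  have hK0 : (0 : ℝ) < 18 * q := mul_pos (by norm_num) hq0
  have hab : (2 : ℝ) < (1 - δ / 8) * (2 + δ) := by
    nlinarith [mul_pos hδ (show (0 : ℝ) < 6 - δ by linarith)]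
  obtain ⟨m₁, hm₁⟩ := eventually_dominates (18 * q) 2 ((1 - δ / 8) * (2 + δ)) hK0 hab
  refine ⟨max 1 m₁, fun m hm r hr p hp => ?_⟩
  have hm1 : 1 ≤ m := le_trans (le_max_left _ _) hm
  have hmm₁ : m₁ ≤ m := le_trans (le_max_right _ _) hm
  have hm1R : (1 : ℝ) ≤ m := by exact_mod_cast hm1
  have hm0R : (0 : ℝ) ≤ m := zero_le_one.trans hm1R
  have hKm : 18 * q * (m : ℝ) ^ (2 : ℝ) ≤ (m : ℝ) ^ ((1 - δ / 8) * (2 + δ)) := hm₁ m hmm₁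
  /- `X = 18 m²`, `A = X ^ (1/(2+δ))`, `n₁ = ⌈A⌉₊`, `n = max n₀ n₁ ≤ B = (n₀ + 2) A` -/
  set X : ℝ := 18 * (m : ℝ) ^ (2 : ℝ) with hX
  have hX1 : 1 ≤ X := by
    have : (1 : ℝ) ≤ (m : ℝ) ^ (2 : ℝ) := Real.one_le_rpow hm1R (by norm_num)
    rw [hX]
    linarith
  have hX0 : 0 ≤ X := zero_le_one.trans hX1
  set A : ℝ := X ^ (2 + δ)⁻¹ with hA
  have hA1 : 1 ≤ A := Real.one_le_rpow hX1 (inv_nonneg.mpr h2δ.le)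
  have hA0 : 0 ≤ A := zero_le_one.trans hA1
  set n₁ : ℕ := ⌈A⌉₊ with hn₁
  set B : ℝ := ((n₀ : ℝ) + 2) * A with hB
  have hB0 : 0 ≤ B := mul_nonneg h02 hA0
  have hnB : ((max n₀ n₁ : ℕ) : ℝ) ≤ B := by
    rw [Nat.cast_max, hB]
    refine max_le ?_ ?_
    · nlinarith [mul_nonneg (n₀.cast_nonneg : (0 : ℝ) ≤ n₀) (sub_nonneg.mpr hA1)]
    · have h1 : (n₁ : ℝ) < A + 1 := Nat.ceil_lt_add_one hA0
      nlinarith [mul_nonneg (n₀.cast_nonneg : (0 : ℝ) ≤ n₀) hA0]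
  /- key: `B ^ (2+δ) = q X = 18 q m² ≤ m ^ ((1-δ/8)(2+δ))`, so `B ≤ m ^ (1-δ/8)` -/
  have hBpow : B ^ (2 + δ) = q * X := by
    rw [hB, Real.mul_rpow h02 hA0, hA, Real.rpow_inv_rpow hX0 h2δ.ne']
  have hkey : B ^ (2 + δ) ≤ (m : ℝ) ^ ((1 - δ / 8) * (2 + δ)) := by
    rw [hBpow]
    calc q * X = 18 * q * (m : ℝ) ^ (2 : ℝ) := by rw [hX]; ring
      _ ≤ (m : ℝ) ^ ((1 - δ / 8) * (2 + δ)) := hKm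
  have hBT : B ≤ (m : ℝ) ^ (1 - δ / 8) := by
    calc B = (B ^ (2 + δ)) ^ (2 + δ)⁻¹ := (Real.rpow_rpow_inv hB0 h2δ.ne').symm
      _ ≤ ((m : ℝ) ^ ((1 - δ / 8) * (2 + δ))) ^ (2 + δ)⁻¹ :=
          Real.rpow_le_rpow (Real.rpow_nonneg hB0 _) hkey (inv_nonneg.mpr h2δ.le)
      _ = (m : ℝ) ^ (1 - δ / 8) := by
          rw [← Real.rpow_mul hm0R, mul_inv_cancel_right₀ h2δ.ne']
  have hT1 : (1 : ℝ) ≤ (m : ℝ) ^ (1 - δ / 8) := Real.one_le_rpow hm1R (by linarith)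
  refine ⟨max n₀ n₁, le_max_left _ _, ?_, ?_, ?_⟩
  · /- `n ≤ r` -/
    have hle : ((max n₀ n₁ : ℕ) : ℝ) ≤ (r : ℝ) := (hnB.trans hBT).trans hr
    exact_mod_cast hle
  · /- `p ≤ n ^ (2+δ)` -/
    have hpX : (p : ℝ) ≤ X := by
      calc (p : ℝ) ≤ ((18 * m ^ 2 : ℕ) : ℝ) := by exact_mod_cast hp
        _ = X := by rw [hX, Real.rpow_two]; push_cast; ring
    have hAn : A ≤ ((max n₀ n₁ : ℕ) : ℝ) :=
      (Nat.le_ceil A).trans (by exact_mod_cast le_max_right n₀ n₁)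
    calc (p : ℝ) ≤ X := hpX
      _ = A ^ (2 + δ) := by rw [hA, Real.rpow_inv_rpow hX0 h2δ.ne']
      _ ≤ ((max n₀ n₁ : ℕ) : ℝ) ^ (2 + δ) := Real.rpow_le_rpow hA0 hAn h2δ.le
  · /- `n ^ (2-δ) ≤ (m ^ (1-δ/8)) ^ 2` -/
    calc ((max n₀ n₁ : ℕ) : ℝ) ^ (2 - δ) ≤ ((m : ℝ) ^ (1 - δ / 8)) ^ (2 - δ) :=
          Real.rpow_le_rpow (by positivity) (hnB.trans hBT) (by linarith)
      _ ≤ ((m : ℝ) ^ (1 - δ / 8)) ^ (2 : ℝ) := Real.rpow_le_rpow_of_exponent_le hT1 (by linarith)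
      _ = ((m : ℝ) ^ (1 - δ / 8)) ^ 2 := Real.rpow_two _

/-! ## One gadget level, explicitly: a prime host `p ≤ 18 m²` -/

/-- **A self-converse gadget in `ℤ/m` is an SDPP family in a prime `p ≤ 18 m²`, sizes multiplied along `π`.**
If the letters `(P c, Q c)_{c<r}` in `ZMod m` (`1 ≤ m`) are direct and `π` strongly separates every ordered
pair of distinct letters directly or after `π`, then some prime `p ≤ 18 m²` carries `r` pairs
`(A σ, B σ)` in `ZMod p` satisfying (W) and (X) with `|A σ| |B σ| = |P σ||Q σ| · |P (π σ)||Q (π σ)|`.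
Proof: the product blocks `(P σ ×ˢ P (π σ), Q σ ×ˢ Q (π σ))` of `ZMod m × ZMod m` satisfy (W), (X)
(`CapacityLift.selfConverseLift`), and the carry-free Bertrand transfer `exists_prime_sdpp_of_addEquiv`
with the two cyclic factors `ZMod m × ZMod m ≃+ (Fin 2 → ZMod m)` keeps both clauses and all sizes,
`p ≤ 2·3²·m²`. -/
theorem exists_prime_sdpp_of_selfConverseGadget {m r : ℕ} (hm : 1 ≤ m)
    (P Q : Fin r → Finset (ZMod m)) (π : Fin r → Fin r)
    (hD : ∀ c : Fin r, ∀ x ∈ P c, ∀ x' ∈ P c, ∀ y ∈ Q c, ∀ y' ∈ Q c,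
      (x - x') + (y - y') = 0 → x = x' ∧ y = y')
    (hS : ∀ σ τ : Fin r, σ ≠ τ →
      (∀ p ∈ P σ, ∀ q ∈ Q τ, ∀ c : Fin r, ∀ p' ∈ P c, ∀ q' ∈ Q c, q - p ≠ q' - p') ∨
      (∀ p ∈ P (π σ), ∀ q ∈ Q (π τ), ∀ c : Fin r, ∀ p' ∈ P c, ∀ q' ∈ Q c, q - p ≠ q' - p')) :
    ∃ p : ℕ, p.Prime ∧ p ≤ 18 * m ^ 2 ∧ ∃ A B : Fin r → Finset (ZMod p),
      (∀ i : Fin r, ∀ a ∈ A i, ∀ a' ∈ A i, ∀ b ∈ B i, ∀ b' ∈ B i,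
          (a - a') + (b - b') = 0 → a = a' ∧ b = b') ∧
      (∀ i j k : Fin r, ∀ a ∈ A i, ∀ a' ∈ A j, ∀ b ∈ B j, ∀ b' ∈ B k,
          (a - a') + (b - b') = 0 → i = k) ∧
      ∀ σ : Fin r, (A σ).card * (B σ).card =
        ((P σ).card * (Q σ).card) * ((P (π σ)).card * (Q (π σ)).card) := by
  -- the two-letter lift: blocks `(P σ ×ˢ P (π σ), Q σ ×ˢ Q (π σ))` in `ZMod m × ZMod m`
  obtain ⟨hW₂, hX₂⟩ := CapacityLift.selfConverseLift P Q hD π hS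
  -- transfer into a prime cyclic host (tree: route support CyclicReduction, transfer step, `k = 2`)
  obtain ⟨p, hp, hpR, A', B', hcard, hW', hX'⟩ :=
    exists_prime_sdpp_of_addEquiv (A := fun σ => P σ ×ˢ P (π σ)) (B := fun σ => Q σ ×ˢ Q (π σ))
      hW₂ hX₂ (m := fun _ : Fin 2 => m) (fun _ => hm)
      (RingEquiv.piFinTwo fun _ : Fin 2 => ZMod m).symm.toAddEquiv
  rw [Fin.prod_const] at hpR
  refine ⟨p, hp, ?_, A', B', hW', hX', fun σ => ?_⟩
  · calc p ≤ 2 * (3 ^ 2 * m ^ 2) := hpR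
      _ = 18 * m ^ 2 := by ring
  · obtain ⟨h1, h2⟩ := hcard σ
    simp only [h1, h2, Finset.card_product]
    ring

/-! ## (⇒) Self-converse gadgets give every slice `0 < δ ≤ 1` of the crux -/

/-- **Gadgets give the slice `δ ∈ (0, 1]` of the crux, explicitly.**  Take a self-converse gadget of slice
`ε = δ/8` at a level `m ≥ 1` beyond the threshold of `bookkeeping_two`, move it into a prime `p ≤ 18 m²`
(`exists_prime_sdpp_of_selfConverseGadget`), and keep the first `n` pairs (`n` from `bookkeeping_two`):
`p ≤ n ^ (2+δ)`, `n ≤ r`, and `n ^ (2-δ) ≤ (m ^ (1-δ/8))² ≤ |P σ||Q σ| · |P (π σ)||Q (π σ)|`. -/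
private theorem slice_of_gadgets
    (h : ∀ ε : ℝ, 0 < ε → ∀ m₀ : ℕ, ∃ m ≥ m₀, ∃ r : ℕ, ∃ P Q : Fin r → Finset (ZMod m),
      ∃ π : Fin r → Fin r,
      (∀ c : Fin r, ∀ x ∈ P c, ∀ x' ∈ P c, ∀ y ∈ Q c, ∀ y' ∈ Q c,
          (x - x') + (y - y') = 0 → x = x' ∧ y = y') ∧
      (∀ σ τ : Fin r, σ ≠ τ →
        (∀ p ∈ P σ, ∀ q ∈ Q τ, ∀ c : Fin r, ∀ p' ∈ P c, ∀ q' ∈ Q c, q - p ≠ q' - p') ∨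
        (∀ p ∈ P (π σ), ∀ q ∈ Q (π τ), ∀ c : Fin r, ∀ p' ∈ P c, ∀ q' ∈ Q c, q - p ≠ q' - p')) ∧
      (m : ℝ) ^ (1 - ε) ≤ (r : ℝ) ∧
      ∀ c : Fin r, (m : ℝ) ^ (1 - ε) ≤ (((P c).card * (Q c).card : ℕ) : ℝ))
    {δ : ℝ} (hδ : 0 < δ) (hδ1 : δ ≤ 1) (n₀ : ℕ) :
    ∃ n ≥ n₀, ∃ p : ℕ, p.Prime ∧ ∃ A B : Fin n → Finset (ZMod p),
      (∀ i : Fin n, ∀ a ∈ A i, ∀ a' ∈ A i, ∀ b ∈ B i, ∀ b' ∈ B i,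
          (a - a') + (b - b') = 0 → a = a' ∧ b = b') ∧
      (∀ i j k : Fin n, ∀ a ∈ A i, ∀ a' ∈ A j, ∀ b ∈ B j, ∀ b' ∈ B k,
          (a - a') + (b - b') = 0 → i = k) ∧
      (p : ℝ) ≤ (n : ℝ) ^ (2 + δ) ∧
      ∀ i : Fin n, (n : ℝ) ^ (2 - δ) ≤ (((A i).card * (B i).card : ℕ) : ℝ) := by
  obtain ⟨m₀, hm₀⟩ := bookkeeping_two δ hδ hδ1 n₀
  obtain ⟨m, hm, r, P, Q, π, hD, hS, hr, hcov⟩ := h (δ / 8) (by positivity) (max m₀ 1)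
  have hm₀m : m₀ ≤ m := le_trans (le_max_left _ _) hm
  have hm1 : 1 ≤ m := le_trans (le_max_right _ _) hm
  -- one level: a prime host `p ≤ 18 m²` for all `r` blocks, sizes multiplied along `π`
  obtain ⟨p, hp, hp18, A', B', hW', hX', hcard⟩ :=
    exists_prime_sdpp_of_selfConverseGadget hm1 P Q π hD hS
  -- the number of blocks kept
  obtain ⟨n, hn₀, hnr, hpn, hnT⟩ := hm₀ m hm₀m r hr p hp18
  refine ⟨n, hn₀, p, hp, A' ∘ Fin.castLE hnr, B' ∘ Fin.castLE hnr, ?_, ?_, hpn, ?_⟩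
  · intro i
    exact hW' (Fin.castLE hnr i)
  · intro i j k a ha a' ha' b hb b' hb' h0
    exact Fin.castLE_injective hnr (hX' _ _ _ a ha a' ha' b hb b' hb' h0)
  · intro i
    simp only [Function.comp_apply]
    set c : Fin r := Fin.castLE hnr i
    rw [hcard c, Nat.cast_mul]
    have h1 := hcov c
    have h2 := hcov (π c)
    have h0 : (0 : ℝ) ≤ (m : ℝ) ^ (1 - δ / 8) := Real.rpow_nonneg (Nat.cast_nonneg _) _
    calc (n : ℝ) ^ (2 - δ) ≤ ((m : ℝ) ^ (1 - δ / 8)) ^ 2 := hnT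
      _ = (m : ℝ) ^ (1 - δ / 8) * (m : ℝ) ^ (1 - δ / 8) := sq _
      _ ≤ (((P c).card * (Q c).card : ℕ) : ℝ) * (((P (π c)).card * (Q (π c)).card : ℕ) : ℝ) :=
          mul_le_mul h1 h2 h0 (h0.trans h1)

/-! ## (⇐) The crux gives self-converse gadgets, by letter repetition -/

-- the combinatorial part is adapted from Summits/MatrixMultiplication/MatrixMultiplication/Theorems/
--   FourierTwoFamiliesModPPrimeTwoFamiliesStubGadgetsOfCrux.lean; the exponents are made explicit here
/-- **The crux gives self-converse gadgets (letter repetition, explicit exponents).**  From an SDPP witness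
`(A i, B i)_{i<n}` in `ZMod p` of the slice `δ = min ε 1` with `n ≥ m₀ + 2` put `m = p`, `r = n * n`, and
through `e : Fin (n*n) ≃ Fin n × Fin n` let the letter `c` carry `(A (e c).1, B (e c).1)` and
`π c = e.symm ((e c).2, (e c).2)`.  Directness is (W); two distinct letters differ in the first component
(clause (X) separates them directly) or in the second (clause (X) separates their `π`-images); `m₀ ≤ p`
because `m₀ ≤ n ≤ n ^ (2-δ) ≤ |A i||B i| ≤ p` ((W) makes `(a, b) ↦ a + b` injective); and
`p ^ (1-ε) ≤ p ^ (1-δ) ≤ (n ^ (2+δ)) ^ (1-δ) = n ^ (2-δ-δ²) ≤ n ^ (2-δ) ≤ n² = r`. -/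
private theorem gadgets_of_crux (hT : FourierTwoFamiliesModP.PrimeTwoFamilies) :
    ∀ ε : ℝ, 0 < ε → ∀ m₀ : ℕ, ∃ m ≥ m₀, ∃ r : ℕ, ∃ P Q : Fin r → Finset (ZMod m),
      ∃ π : Fin r → Fin r,
      (∀ c : Fin r, ∀ x ∈ P c, ∀ x' ∈ P c, ∀ y ∈ Q c, ∀ y' ∈ Q c,
          (x - x') + (y - y') = 0 → x = x' ∧ y = y') ∧
      (∀ σ τ : Fin r, σ ≠ τ →
        (∀ p ∈ P σ, ∀ q ∈ Q τ, ∀ c : Fin r, ∀ p' ∈ P c, ∀ q' ∈ Q c, q - p ≠ q' - p') ∨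
        (∀ p ∈ P (π σ), ∀ q ∈ Q (π τ), ∀ c : Fin r, ∀ p' ∈ P c, ∀ q' ∈ Q c, q - p ≠ q' - p')) ∧
      (m : ℝ) ^ (1 - ε) ≤ (r : ℝ) ∧
      ∀ c : Fin r, (m : ℝ) ^ (1 - ε) ≤ (((P c).card * (Q c).card : ℕ) : ℝ) := by
  intro ε hε m₀
  -- the slice `δ = min ε 1` of the crux, with `n ≥ m₀ + 2` pairs
  set δ : ℝ := min ε 1
  have hδ : 0 < δ := lt_min hε one_pos
  have hδε : δ ≤ ε := min_le_left _ _
  have hδ1 : δ ≤ 1 := min_le_right _ _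
  obtain ⟨n, hn, p, hp, A, B, hW, hX, hpn, hAB⟩ := hT δ hδ (m₀ + 2)
  haveI : Fact p.Prime := ⟨hp⟩
  have hn1 : 1 ≤ n := by omega
  have hn1R : (1 : ℝ) ≤ n := by exact_mod_cast hn1
  have hp1R : (1 : ℝ) ≤ p := by exact_mod_cast hp.one_lt.le
  -- `m₀ ≤ p`: `m₀ + 2 ≤ n ≤ n ^ (2-δ) ≤ |A i₀| |B i₀| ≤ p`
  have i₀ : Fin n := ⟨0, by omega⟩
  have hm₀ : m₀ ≤ p := by
    have h1 : (A i₀).card * (B i₀).card ≤ p := by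
      have := card_mul_card_le_of_dpp (H := ZMod p) (hW i₀)
      rwa [ZMod.card] at this
    have h2 : (n : ℝ) ≤ (n : ℝ) ^ (2 - δ) := by
      calc (n : ℝ) = (n : ℝ) ^ (1 : ℝ) := (Real.rpow_one _).symm
        _ ≤ (n : ℝ) ^ (2 - δ) := Real.rpow_le_rpow_of_exponent_le hn1R (by linarith)
    have h3 : (n : ℝ) ≤ (p : ℝ) := (h2.trans (hAB i₀)).trans (by exact_mod_cast h1)
    have h4 : n ≤ p := by exact_mod_cast h3
    omega
  -- explicit exponents: `p ^ (1-ε) ≤ p ^ (1-δ) ≤ (n ^ (2+δ)) ^ (1-δ) = n ^ ((2+δ)(1-δ)) ≤ n ^ (2-δ)`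
  have hcov : (p : ℝ) ^ (1 - ε) ≤ (n : ℝ) ^ (2 - δ) := by
    calc (p : ℝ) ^ (1 - ε) ≤ (p : ℝ) ^ (1 - δ) :=
          Real.rpow_le_rpow_of_exponent_le hp1R (by linarith)
      _ ≤ ((n : ℝ) ^ (2 + δ)) ^ (1 - δ) := Real.rpow_le_rpow (Nat.cast_nonneg _) hpn (by linarith)
      _ = (n : ℝ) ^ ((2 + δ) * (1 - δ)) := (Real.rpow_mul (Nat.cast_nonneg _) _ _).symm
      _ ≤ (n : ℝ) ^ (2 - δ) := Real.rpow_le_rpow_of_exponent_le hn1R (by nlinarith [sq_nonneg δ])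
  -- strong separation of letters with distinct indices, from clause (X) at `(i, j, k)`
  have hsep : ∀ i k : Fin n, i ≠ k → ∀ x ∈ A i, ∀ y ∈ B k, ∀ j : Fin n, ∀ x' ∈ A j, ∀ y' ∈ B j,
      y - x ≠ y' - x' := by
    intro i k hik x hx y hy j x' hx' y' hy' heq
    have h0 : (x - x') + (y' - y) = 0 := by
      rw [show (x - x') + (y' - y) = (y' - x') - (y - x) by abel, heq, sub_self]
    exact hik (hX i j k x hx x' hx' y' hy' y hy h0)
  -- letter repetition: `r = n * n` letters, letter `(i, i')` carries `(A i, B i)`, `π (i, i') = (i', i')`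
  have e : Fin (n * n) ≃ Fin n × Fin n := finProdFinEquiv.symm
  refine ⟨p, hm₀, n * n, fun c => A (e c).1, fun c => B (e c).1,
    fun c => e.symm ((e c).2, (e c).2), fun c => hW (e c).1, ?_, ?_,
    fun c => hcov.trans (hAB (e c).1)⟩
  · intro σ τ hστ
    by_cases h1 : (e σ).1 = (e τ).1
    · -- same first index: the second indices differ, separate the `π`-images
      right
      have h2 : (e σ).2 ≠ (e τ).2 := fun h2 => hστ (e.injective (Prod.ext h1 h2))
      intro x hx y hy c x' hx' y' hy'
      simp only [Equiv.apply_symm_apply] at hx hy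
      exact hsep _ _ h2 x hx y hy _ x' hx' y' hy'
    · -- distinct first indices: separate directly
      left
      intro x hx y hy c x' hx' y' hy'
      exact hsep _ _ h1 x hx y hy _ x' hx' y' hy'
  · -- `p ^ (1-ε) ≤ n ^ (2-δ) ≤ n² = r`
    calc (p : ℝ) ^ (1 - ε) ≤ (n : ℝ) ^ (2 - δ) := hcov
      _ ≤ (n : ℝ) ^ (2 : ℝ) := Real.rpow_le_rpow_of_exponent_le hn1R (by linarith)
      _ = ((n * n : ℕ) : ℝ) := by rw [Real.rpow_two, sq, Nat.cast_mul]

/-! ## The registered stub -/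

/-- **Self-converse gadgets ↔ `PrimeTwoFamilies`** (registered stub `selfConverseGadgets_iff_primeTwoFamilies`
of crux stmt-MatrixMultiplication-14308, explicit two-letter route).  Self-converse gadgets of every slice
`ε > 0` — arbitrarily large `m`, `r ≥ m ^ (1-ε)` direct pairs `(P c, Q c)` in `ZMod m` of co-volume
`≥ m ^ (1-ε)` and a map `π` under which every ordered pair of distinct letters is strongly separated directly
or after `π` — exist iff CKSU Conj. 4.7 with prime cyclic hosts holds.  (⇒) `slice_of_gadgets` for the
slices `0 < δ ≤ 1` (two-letter lift, carry-free transfer into a prime `p ≤ 18 m²`, explicit bookkeeping)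
and, for `δ > 1`, the slice `min δ 1` weakened along `n ≥ 1`; (⇐) `gadgets_of_crux` (letter repetition).
The L = 2 form of the capacity line is therefore equivalent to, not stronger than, the crux. -/
theorem selfConverseGadgets_iff_primeTwoFamilies :
    (∀ ε : ℝ, 0 < ε → ∀ m₀ : ℕ, ∃ m ≥ m₀, ∃ r : ℕ, ∃ P Q : Fin r → Finset (ZMod m),
      ∃ π : Fin r → Fin r,
      (∀ c : Fin r, ∀ x ∈ P c, ∀ x' ∈ P c, ∀ y ∈ Q c, ∀ y' ∈ Q c,
          (x - x') + (y - y') = 0 → x = x' ∧ y = y') ∧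
      (∀ σ τ : Fin r, σ ≠ τ →
        (∀ p ∈ P σ, ∀ q ∈ Q τ, ∀ c : Fin r, ∀ p' ∈ P c, ∀ q' ∈ Q c, q - p ≠ q' - p') ∨
        (∀ p ∈ P (π σ), ∀ q ∈ Q (π τ), ∀ c : Fin r, ∀ p' ∈ P c, ∀ q' ∈ Q c, q - p ≠ q' - p')) ∧
      (m : ℝ) ^ (1 - ε) ≤ (r : ℝ) ∧
      ∀ c : Fin r, (m : ℝ) ^ (1 - ε) ≤ (((P c).card * (Q c).card : ℕ) : ℝ)) ↔
    FourierTwoFamiliesModP.PrimeTwoFamilies := by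
  refine ⟨fun h => ?_, gadgets_of_crux⟩
  -- slices `0 < δ ≤ 1` by `slice_of_gadgets`; a slice `δ > 1` from the slice `min δ 1`, since `n ≥ 1`
  intro δ hδ n₀
  obtain ⟨n, hn, p, hp, A, B, hW, hX, hpn, hAB⟩ :=
    slice_of_gadgets h (lt_min hδ one_pos) (min_le_right δ 1) (n₀ + 1)
  have hn1 : (1 : ℝ) ≤ n := by exact_mod_cast (show 1 ≤ n by omega)
  refine ⟨n, by omega, p, hp, A, B, hW, hX, ?_, fun i => ?_⟩
  · exact hpn.trans (Real.rpow_le_rpow_of_exponent_le hn1 (by linarith [min_le_left δ 1]))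
  · exact (Real.rpow_le_rpow_of_exponent_le hn1 (by linarith [min_le_left δ 1])).trans (hAB i)

end Summit.MatrixMultiplication.MatrixMultiplication.Theorems.PrimeTwoFamilies.SelfConverseExplicitK14
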